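import Mathlib
import HarnessLib
import Literature.Analysis.FluidPDE.Tao2016AveragedNS.LocalCascadeSolutions
import Literature.Analysis.FluidPDE.Tao2016AveragedNS.RestartedCascadeFlows

/-!
# Taylor-model chain certificates for the window-truncated cascade ODE (Tao 2016, ε₀ = 1) — vocabulary

Definition-only module (no facts): the data record `TaylorChain.CertData` of a sub-stepped validated-integration
certificate ("Taylor model with parallelepiped remainder frames", Lohner 1987 / Makino–Berz 2005, for the
quadratic field `quadTerm 1 α` truncated to a window of shells `[-Kb, Ka]`) and the predicates `Static`,
`StageNumerics`, `Chain`, `Readouts`, `Valid` on it.  Every clause is an explicit real inequality in the data or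
a `∀` over an explicit box of window states — no flow, crossing time or derivative is quantified — so an explicit
`d` is checkable clause by clause.  Wanted by the summit-side route `TaylorModelRungThree` / line `taylor-model`
on `ExactWindowRungThree.DerivativeEnclosureCertificateR` (NavierStokesRegularity, rung TL-M3), whose item
`TaylorModelChainCertificateR := ∃ d : CertData, d.Static ∧ d.StageNumerics ∧ d.Chain ∧ d.Readouts` must stay a
one-line statement; the analytic soundness (Cauchy majorants) and the readout into the flow-quantified crux are
summit-side items, not stated here.

* `Static` / `StageNumerics`: the static (S), datum (D) and per-stage numeric (N)(U)(DIST) clauses of that crux,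
  verbatim over the record's fields, plus the weighted bilinear bound (B) of the truncated field.
* `Chain`: per stage `j ≤ N₀` — nodes `Tn`, window-supported centres `x j s` with Taylor jets `P j s n` (degree
  `pdeg`) of the polarised truncated field `Qb` and variational jets `Wv j s n`; frames `Cm j s` with exact
  inverses `Ci j s` on window vectors, parallelepiped radii `rP j s`; box radii `EI ≤ E ≤ EO` (base point / entry
  polytope / κ-restart level) and spreads `SpI, Sp, SpO`; the majorant step inequalities built from `Rem`, `RemV`,
  `Dev`; the parallelepiped update in the next frame; the κ-entry `E + L1·κ ≤ EO`; the frame-adapted variation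
  defect `κB`; the window M-bounds during every sub-step.
* `Readouts`: flow-Lipschitz products for `Λ j`, a linear section `σf j = lev j` crossed transversally (`γ j > 0`)
  inside the last sub-step, and at the crossing states the front amplitude `as`, behind-landing and base landing
  with C¹ allowance `β j l ≥ NDL·ΛX·dm` into the successor polytope shrunk by `s`.

Plain `structure` + `Prop`-valued `def`s; no instances, no notation; no named facts (nothing here is asserted).
Sources of the FORMAT (not of any claim): Taylor models with interval/majorant remainder [MakinoBerz2003,
Def. 1], verified integration of ODE flows by Taylor models [BerzMakino1998], Lohner-type parallelepiped
frames and C¹ (variational) enclosures [Zgliczynski2002C1Lohner]; the field is Tao's cascade ODE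
[Tao2016AveragedNS, §4 Lemma 4.1]. Filed for the definition request `defn-TaylorChain.CertData` (planner-ns-idea-2),
ready-made by the requester, re-tagged by the literature-prover; the two majorant-convergence guards in `Chain`
(`bb·mC·h < 1`, `bb·(mC+ρO)·h < 1` per sub-step) were added at review (p593199) so that `Valid` admits no
junk-denominator certificate.
-/

noncomputable section

namespace Literature.Analysis.FluidPDE.TaoCascade.TaylorChain

open scoped BigOperators
open Set

/-- The certificate data of a sub-stepped Taylor-model chain for one window chain (all real data intended
dyadic-rational; functions beyond the finitely many indices used are junk-valued): Taylor jets `P`, variational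
jets `Wv`, frames `Cm`/`Ci` with parallelepiped radii `rP`, remainder/box radii `EI ≤ E ≤ EO`, read-out data.
[cite: MakinoBerz2003, Definition 1 (Taylor model = polynomial + remainder bound); cell certificate format, window-truncated cascade]
[cite: Zgliczynski2002C1Lohner, §3–4 (Lohner-type parallelepiped frames and the C¹/variational enclosure); cell certificate format, window-truncated cascade] -/
structure CertData where
  (R θ c η₀ Cb Cg τs mm : ℝ)
  (Kb Ka : ℤ)
  i₀ : Fin 4
  α : Fin 4 → Fin 4 → Fin 4 → ℤ × ℤ × ℤ → ℝ
  X₀ : Fin 4 → ℝ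
  (M W : ℤ → ℝ)
  (N₀ pdeg : ℕ)
  ℓ : ℕ → ℕ → (Fin 4 → ℤ → ℝ) →ₗ[ℝ] ℝ
  (ctr rad s : ℕ → ℕ → ℝ)
  ω : ℕ → ℤ → ℝ
  (Lv as κ Λ δ bb γ Nσ lev dm ΛX : ℕ → ℝ)
  (nx S : ℕ → ℕ)
  (β NDL : ℕ → ℕ → ℝ)
  σf : ℕ → (Fin 4 → ℤ → ℝ) →ₗ[ℝ] ℝ
  (h Tn mC mT EI E EO ρ ρO NVh NV dP SpI Sp SpO L1 NCi κB : ℕ → ℕ → ℝ)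
  x : ℕ → ℕ → (Fin 4 → ℤ → ℝ)
  P : ℕ → ℕ → ℕ → (Fin 4 → ℤ → ℝ)
  Wv : ℕ → ℕ → ℕ → (Fin 4 → ℤ → ℝ) → (Fin 4 → ℤ → ℝ)
  (Cm Ci : ℕ → ℕ → (Fin 4 → ℤ → ℝ) → (Fin 4 → ℤ → ℝ))
  rP : ℕ → ℕ → (Fin 4 → ℤ → ℝ)

namespace CertData

variable (d : CertData)

/-- The window-truncated cascade field (ε₀ = 1): `quadTerm` of the window-truncated state, zero off the window.
[cite: Tao2016AveragedNS, §4 Lemma 4.1 (iii) (4.5)–(4.11) (equations of motion of the cascade); cell vocabulary, window-truncated] -/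
def qT (y : (Fin 4 → ℤ → ℝ)) (i : Fin 4) (k : ℤ) : ℝ :=
  if -d.Kb ≤ k ∧ k ≤ d.Ka then Literature.Analysis.FluidPDE.TaoCascade.quadTerm 1 d.α (fun j' n' (_ : ℝ) => if -d.Kb ≤ n' ∧ n' ≤ d.Ka then y j' n' else 0) i k 0 else 0

/-- Its symmetric bilinear polarisation `Qb(u,v) = (q(u+v) − q(u) − q(v))/2`. [cite: Tao2016AveragedNS, §4 Lemma 4.1 (iii) (4.5)–(4.11) (equations of motion of the cascade); cell vocabulary, window-truncated] -/
def Qb (u v : (Fin 4 → ℤ → ℝ)) : (Fin 4 → ℤ → ℝ) := fun i k => (d.qT (u + v) i k - d.qT u i k - d.qT v i k) / 2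

/-- Weighted sup-norm ball of stage `j` (weights `ω j`), window coordinates only (the interval/box part of a
Taylor model). [cite: MakinoBerz2003, Definition 1 (Taylor model = polynomial + remainder bound); cell certificate format, window-truncated cascade] -/
def InBall (j : ℕ) (y : (Fin 4 → ℤ → ℝ)) (N : ℝ) : Prop := ∀ i k, -d.Kb ≤ k → k ≤ d.Ka → |y i k| ≤ N * d.ω j k

/-- Window-supported vectors (zero off the shell window `[-Kb, Ka]`). [cite: Tao2016AveragedNS, §4 Lemma 4.1 (iii) (4.5)–(4.11) (equations of motion of the cascade); cell vocabulary, window-truncated] -/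
def Wsupp (y : (Fin 4 → ℤ → ℝ)) : Prop := ∀ i k, ¬(-d.Kb ≤ k ∧ k ≤ d.Ka) → y i k = 0

/-- Cauchy-majorant Taylor remainder `m q^(p+1)/(1-q)`, `q = b m u`, `p = pdeg` (the remainder bound of the
degree-`p` Taylor model of the flow of a quadratic field with bilinear bound `b`). [cite: BerzMakino1998, §2–3 (verified integration of ODE flows by Taylor models: Picard/majorant step); cell certificate format, window-truncated cascade] -/
def Rem (b m u : ℝ) : ℝ := m * (b * m * u) ^ (d.pdeg + 1) / (1 - b * m * u)

/-- Tail of the first-variation majorant series `Σ_(k>p) (k+1) q^k` (remainder bound for the variational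
Taylor model). [cite: BerzMakino1998, §2–3 (verified integration of ODE flows by Taylor models: Picard/majorant step); cell certificate format, window-truncated cascade] -/
def RemV (b m u : ℝ) : ℝ := (((d.pdeg : ℝ) + 2) * (b * m * u) ^ (d.pdeg + 1) - ((d.pdeg : ℝ) + 1) * (b * m * u) ^ (d.pdeg + 2)) / (1 - b * m * u) ^ 2

/-- Second-order deviation majorant `g(m+r) - g(m) - r g'(m)`, `g(z) = z/(1 - b z u)` (nonlinearity defect of the
majorant flow). [cite: BerzMakino1998, §2–3 (verified integration of ODE flows by Taylor models: Picard/majorant step); cell certificate format, window-truncated cascade] -/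
def Dev (b m r u : ℝ) : ℝ := (m + r) / (1 - b * (m + r) * u) - m / (1 - b * m * u) - r / (1 - b * m * u) ^ 2

/-- The normalised landing map into stage `nx j` (tail coordinates `v`), as in the cell's crux K1b-DR
(restart of the cascade flow at the next shell). [cite: Tao2016AveragedNS, §4 Lemma 4.1 (4.5)–(4.11) (the cascade
and its shells); cell vocabulary, window-truncated] -/
def land (j : ℕ) (y : (Fin 4 → ℤ → ℝ)) (v : Fin 4 → ℝ) : (Fin 4 → ℤ → ℝ) :=
  fun i k => d.Lv (d.nx j) * (if k + 1 ≤ d.Ka then y i (1 + k) else v i) / |y d.i₀ 1|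

/-- Directional derivative of the landing map `land j · v` at `y` in the direction `z` (the explicit formula
for `d/dε land j (y + ε z) v` at `ε = 0`, valid when `y i₀ 1 ≠ 0`), used to state the C¹ read-out bound
ALGEBRAICALLY — no Fréchet derivative on the infinite product `Fin 4 → ℤ → ℝ`, whose differential calculus
Mathlib has only in topological-vector-space generality (definition, uniqueness, linear maps; no chain or
product rule). [cite: Zgliczynski2002C1Lohner, §3–4 (C¹-Lohner: derivative of the Poincaré/section map transported explicitly); cell certificate format, window-truncated cascade] -/
def landD (j : ℕ) (y : (Fin 4 → ℤ → ℝ)) (v : Fin 4 → ℝ) (z : (Fin 4 → ℤ → ℝ)) : (Fin 4 → ℤ → ℝ) :=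
  fun i k => d.Lv (d.nx j) * ((if k + 1 ≤ d.Ka then z i (1 + k) else 0) / |y d.i₀ 1| -
    (if k + 1 ≤ d.Ka then y i (1 + k) else v i) * (Real.sign (y d.i₀ 1) * z d.i₀ 1) / (y d.i₀ 1) ^ 2)

/-- Taylor polynomial of the centre trajectory of sub-step `s` of stage `j` (polynomial part of the Taylor
model). [cite: MakinoBerz2003, Definition 1 (Taylor model = polynomial + remainder bound); cell certificate format, window-truncated cascade] -/
def TP (j s : ℕ) (u : ℝ) : (Fin 4 → ℤ → ℝ) := fun i k => ∑ n ∈ Finset.range (d.pdeg + 1), d.P j s n i k * u ^ n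

/-- Taylor polynomial of the first variation at the centre of sub-step `s` of stage `j` (polynomial part of
the variational Taylor model). [cite: Zgliczynski2002C1Lohner, §3–4 (Lohner-type parallelepiped frames and the C¹/variational enclosure); cell certificate format, window-truncated cascade] -/
def Vap (j s : ℕ) (u : ℝ) (v : (Fin 4 → ℤ → ℝ)) : (Fin 4 → ℤ → ℝ) := fun i k => ∑ n ∈ Finset.range (d.pdeg + 1), d.Wv j s n v i k * u ^ n

/-- (S)+(D): static clauses and datum clause of the cell's crux K1b-DR
(`ExactWindowRungThree.DerivativeEnclosureCertificateR`), verbatim over the record's fields — a PREDICATE on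
the data, asserting nothing. [cite: Tao2016AveragedNS, §4 Lemma 4.1 (4.5)–(4.11) (the cascade whose truncation
is certified); cell certificate format, window-truncated cascade] -/
def Static (d : CertData) : Prop :=
  1 ≤ d.R ∧ Literature.Analysis.FluidPDE.TaoCascade.InTableClass d.R d.α ∧ d.X₀ d.i₀ ≠ 0 ∧ 0 ≤ d.θ ∧ d.θ < 1/2 ∧ 0 < d.c ∧ 0 < d.η₀ ∧ d.η₀ ≤ 1 ∧ 0 < d.Cb ∧ 0 < d.Cg ∧ 0 ≤ d.Kb ∧ 1 ≤ d.Ka ∧ 0 < d.τs ∧ d.τs ≤ d.c ∧ 0 < d.mm ∧ (∀ k, -d.Kb ≤ k → k ≤ d.Ka → 0 < d.M k ∧ 0 ≤ d.W k) ∧ d.c*(68*d.Cb*(2:ℝ) ^ (-(7:ℝ)/4*((d.Kb:ℝ) + 1)) + 47*d.M (-d.Kb)*(2:ℝ) ^ (-(5:ℝ)/2*((d.Kb:ℝ) + 1))) ≤ 1/8 ∧ 2560*d.c*d.M d.Ka ^ 2*(2:ℝ) ^ (6*(d.Ka:ℝ)) ≤ Real.sqrt d.Cg ∧ 51200*d.c*Real.sqrt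 d.Cg ≤ (2:ℝ) ^ ((d.Ka:ℝ) + 2) ∧ (∀ (L : ℕ) (k : ℤ), -d.Kb ≤ k → k ≤ d.Ka → 2*Literature.Analysis.FluidPDE.TaoCascade.slackWeight 1 d.θ d.c (fun j : ℤ => if j < -d.Kb then 2*(d.Cb*(2:ℝ) ^ ((3:ℝ)/4*(-(j:ℝ)))) ^ 2 else if d.Ka < j then 5*(d.Cg*(2:ℝ) ^ (-(7:ℝ)*(j:ℝ))) else (1/2)*d.M j ^ 2 + d.W j) L k + (d.c*(2:ℝ) ^ ((2:ℝ)*(k:ℝ)) + 1)*d.M k ^ 2 ≤ d.W k) ∧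
  (∀ l, |d.ℓ 0 l (Literature.Analysis.FluidPDE.TaoCascade.datumState d.i₀ d.X₀) - d.ctr 0 l| ≤ d.rad 0 l - d.s 0 l)

/-- (N)+(U)+(DIST) of K1b-DR verbatim, and (B) the weighted bilinear bound of the truncated field per stage —
a PREDICATE on the data. [cite: Tao2016AveragedNS, §4 Lemma 4.1 (iii) (4.5)–(4.11) (the quadratic field whose
truncation is bounded); cell certificate format, window-truncated cascade] -/
def StageNumerics (d : CertData) : Prop :=
  (∀ j, j ≤ d.N₀ → d.nx j ≤ d.N₀ ∧ 1 ≤ d.Lv j ∧ (∀ l, 0 ≤ d.s j l) ∧ 0 < d.κ j ∧ 0 ≤ d.Λ j ∧ 0 ≤ d.δ j ∧ (∀ k, 0 < d.ω j k) ∧ d.Λ j*d.δ j*d.τs < d.κ j ∧ (2:ℝ) ^ (-d.θ)*d.Lv (d.nx j) ≤ d.as j - d.Λ j*d.δ j*d.τs*d.ω j 1 ∧ (∀ u : Fin 4 → ℤ → ℝ, (∀ i k, -d.Kb ≤ k → k + 1 ≤ d.Ka → |u i k| ≤ (d.Λ j*d.δ j*d.τs*d.ω j (1 + k) + d.M (1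 + k)*d.Λ j*d.δ j*d.τs*d.ω j 1/d.as j)*(2:ℝ) ^ d.θ) → (∀ i, |u i d.Ka| ≤ Real.sqrt (10*d.Cg*(2:ℝ) ^ (-(7:ℝ)*((d.Ka:ℝ) + 1)))*(2:ℝ) ^ d.θ*d.Λ j*d.δ j*d.τs*d.ω j 1/d.as j) → ∀ l, |d.ℓ (d.nx j) l u| ≤ d.s (d.nx j) l) ∧ (∀ (y : Fin 4 → ℤ → ℝ), (∀ i k, -d.Kb ≤ k → k ≤ d.Ka → |y i k| ≤ d.M k) → (∀ i, |y i (-d.Kb - 1)| ≤ 6/5*(d.Cb*(2:ℝ) ^ ((3:ℝ)/4*((d.Kb:ℝ) + 1)))) → (∀ i, |y i (d.Ka + 1)| ≤ Real.sqrt (10*d.Cg*(2:ℝ) ^ (-(7:ℝ)*((d.Ka:ℝ) + 1)))) → ∀ i k, -d.Kb ≤ k → k ≤ d.Ka → |Literature.Analysis.FluidPDE.TaoCascade.quadTerm 1 d.α (fun j' n (_:ℝ) => y j' n) i k 0 - Literature.Analysis.FluidPDE.TaoCascade.quadTerm 1 d.α (fun j' n (_:ℝ) => if -d.Kb ≤ n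 ∧ n ≤ d.Ka then y j' n else 0) i k 0| + d.η₀*(2:ℝ) ^ ((2:ℝ)*(k:ℝ))*Real.sqrt ((1/2)*d.M k ^ 2 + d.η₀*d.W k) ≤ d.δ j*d.ω j k)) ∧
  (∀ j, j ≤ d.N₀ → 0 ≤ d.bb j ∧ ∀ (u v : (Fin 4 → ℤ → ℝ)) (Nu Nv : ℝ), 0 ≤ Nu → 0 ≤ Nv → d.InBall j u Nu → d.InBall j v Nv → d.InBall j (d.Qb u v) (d.bb j * Nu * Nv))

/-- (TM): the sub-stepped Taylor-model chain of every stage — Taylor jets of the centre and of the first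
variation, the convergence guards `bb·mC·h < 1`, `bb·(mC + ρO)·h < 1` of the majorant series (so that no
denominator of `Rem`/`RemV`/`Dev` or of the `κB` clause is a junk value; `EI ≤ E ≤ ρ ≤ ρO`), majorant step
inequalities (`Rem`, `RemV`, `Dev`), parallelepiped update in the next frame, κ-entry, window `M`-bounds; a
PREDICATE on the data. [cite: BerzMakino1998, §2–3 (verified integration of ODE flows by Taylor models: Picard/majorant step); cell certificate format, window-truncated cascade]
[cite: Zgliczynski2002C1Lohner, §3–4 (Lohner-type parallelepiped frames and the C¹/variational enclosure); cell certificate format, window-truncated cascade] -/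
def Chain (d : CertData) : Prop :=
  ∀ j, j ≤ d.N₀ →
    1 ≤ d.S j ∧ d.Tn j 0 = 0 ∧ d.Tn j (d.S j) ≤ d.τs ∧ d.EI j 0 = 0 ∧ (∀ l, |d.ℓ j l (d.x j 0) - d.ctr j l| ≤ d.rad j l) ∧
    (∀ q : (Fin 4 → ℤ → ℝ), (∀ l, |d.ℓ j l q - d.ctr j l| ≤ d.rad j l) → ∃ ξ e : (Fin 4 → ℤ → ℝ), (∀ i k, -d.Kb ≤ k → k ≤ d.Ka → |ξ i k| ≤ d.rP j 0 i k ∧ q i k = d.x j 0 i k + d.Cm j 0 ξ i k + e i k) ∧ d.InBall j e (d.E j 0) ∧ d.InBall j (d.Cm j 0 ξ + e) (d.dm j)) ∧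
    (∀ s', s' ≤ d.S j →
      d.Wsupp (d.x j s') ∧ (∀ n, d.Wsupp (d.P j s' n)) ∧ 0 ≤ d.mC j s' ∧ d.InBall j (d.x j s') (d.mC j s') ∧
      (∀ i k, 0 ≤ d.rP j s' i k) ∧ 0 ≤ d.EI j s' ∧ d.EI j s' ≤ d.E j s' ∧ d.E j s' ≤ d.EO j s' ∧ d.EO j s' ≤ d.ρO j s' ∧ d.E j s' ≤ d.ρ j s' ∧ d.ρ j s' ≤ d.ρO j s' ∧
      IsLinearMap ℝ (d.Cm j s') ∧ IsLinearMap ℝ (d.Ci j s') ∧ (∀ v, d.Wsupp (d.Cm j s' v) ∧ d.Wsupp (d.Ci j s' v) ∧ (d.Wsupp v → d.Ci j s' (d.Cm j s' v) = v ∧ d.Cm j s' (d.Ci j s' v) = v)) ∧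
      (∀ ξ : (Fin 4 → ℤ → ℝ), (∀ i k, -d.Kb ≤ k → k ≤ d.Ka → |ξ i k| ≤ d.rP j s' i k) → d.InBall j (d.Cm j s' ξ) (d.ρ j s' - d.E j s') ∧ d.InBall j (d.Cm j s' ξ) (d.ρO j s' - d.EO j s')) ∧
      (0 ≤ d.NCi j s' ∧ ∀ v : (Fin 4 → ℤ → ℝ), d.InBall j v 1 → ∀ i k, -d.Kb ≤ k → k ≤ d.Ka → |d.Ci j s' v i k| ≤ d.NCi j s' * d.rP j s' i k) ∧
      d.P j s' 0 = d.x j s' ∧ (∀ n, n < d.pdeg → ∀ i k, ((n : ℝ) + 1) * d.P j s' (n + 1) i k = ∑ m' ∈ Finset.range (n + 1), d.Qb (d.P j s' m') (d.P j s' (n - m')) i k) ∧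
      (∀ v i k, d.Wv j s' 0 v i k = if -d.Kb ≤ k ∧ k ≤ d.Ka then v i k else 0) ∧
      (∀ n, n < d.pdeg → ∀ v i k, ((n : ℝ) + 1) * d.Wv j s' (n + 1) v i k = ∑ m' ∈ Finset.range (n + 1), (d.Qb (d.P j s' m') (d.Wv j s' (n - m') v) i k + d.Qb (d.Wv j s' (n - m') v) (d.P j s' m') i k))) ∧
    (∀ s', s' < d.S j →
      0 < d.h j s' ∧ d.bb j * d.mC j s' * d.h j s' < 1 ∧ d.bb j * (d.mC j s' + d.ρO j s') * d.h j s' < 1 ∧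
      d.Tn j (s' + 1) = d.Tn j s' + d.h j s' ∧
      (∀ u ∈ Set.Icc 0 (d.h j s'), d.InBall j (d.TP j s' u) (d.mT j s')) ∧ 0 ≤ d.SpO j s' ∧
      d.bb j * (d.mT j s' + d.SpO j s' + d.κ j) * d.h j s' < 1 ∧ 1 / (1 - d.bb j * (d.mT j s' + d.SpO j s' + d.κ j) * d.h j s') ^ 2 ≤ d.L1 j s' ∧
      0 ≤ d.NV j s' ∧ (∀ u ∈ Set.Icc 0 (d.h j s'), ∀ (v : (Fin 4 → ℤ → ℝ)) (N : ℝ), 0 ≤ N → d.InBall j v N → d.InBall j (d.Vap j s' u v) (d.NV j s' * N)) ∧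
      0 ≤ d.NVh j s' ∧ (∀ (v : (Fin 4 → ℤ → ℝ)) (N : ℝ), 0 ≤ N → d.InBall j v N → d.InBall j (d.Vap j s' (d.h j s') v) (d.NVh j s' * N)) ∧
      d.InBall j (d.TP j s' (d.h j s') - d.x j (s' + 1)) (d.dP j s') ∧
      d.NV j s' * d.EI j s' + d.Rem (d.bb j) (d.mC j s') (d.h j s') + d.RemV (d.bb j) (d.mC j s') (d.h j s') * d.EI j s' + Dev (d.bb j) (d.mC j s') (d.EI j s') (d.h j s') ≤ d.SpI j s' ∧
      d.NV j s' * d.ρ j s' + d.Rem (d.bb j) (d.mC j s') (d.h j s') + d.RemV (d.bb j) (d.mC j s') (d.h j s') * d.ρ j s' + Dev (d.bb j) (d.mC j s') (d.ρ j s') (d.h j s') ≤ d.Sp j s' ∧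
      d.NV j s' * d.ρO j s' + d.Rem (d.bb j) (d.mC j s') (d.h j s') + d.RemV (d.bb j) (d.mC j s') (d.h j s') * d.ρO j s' + Dev (d.bb j) (d.mC j s') (d.ρO j s') (d.h j s') + d.L1 j s' * d.κ j ≤ d.SpO j s' ∧
      d.dP j s' + d.NVh j s' * d.EI j s' + d.Rem (d.bb j) (d.mC j s') (d.h j s') + d.RemV (d.bb j) (d.mC j s') (d.h j s') * d.EI j s' + Dev (d.bb j) (d.mC j s') (d.EI j s') (d.h j s') ≤ d.EI j (s' + 1) ∧
      d.dP j s' + d.NVh j s' * d.E j s' + d.Rem (d.bb j) (d.mC j s') (d.h j s') + d.RemV (d.bb j) (d.mC j s') (d.h j s') * d.ρ j s' + Dev (d.bb j) (d.mC j s') (d.ρ j s') (d.h j s') ≤ d.E j (s' + 1) ∧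
      d.dP j s' + d.NVh j s' * d.EO j s' + d.Rem (d.bb j) (d.mC j s') (d.h j s') + d.RemV (d.bb j) (d.mC j s') (d.h j s') * d.ρO j s' + Dev (d.bb j) (d.mC j s') (d.ρO j s') (d.h j s') ≤ d.EO j (s' + 1) ∧
      d.E j (s' + 1) + d.L1 j s' * d.κ j ≤ d.EO j (s' + 1) ∧
      (∀ ξ : (Fin 4 → ℤ → ℝ), (∀ i k, -d.Kb ≤ k → k ≤ d.Ka → |ξ i k| ≤ d.rP j s' i k) → ∀ i k, -d.Kb ≤ k → k ≤ d.Ka → |d.Ci j (s' + 1) (d.Vap j s' (d.h j s') (d.Cm j s' ξ)) i k| ≤ d.rP j (s' + 1) i k) ∧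
      d.NCi j (s' + 1) * (d.RemV (d.bb j) (d.mC j s') (d.h j s') + (1 / (1 - d.bb j * (d.mC j s' + d.ρO j s') * d.h j s') ^ 2 - 1 / (1 - d.bb j * d.mC j s' * d.h j s') ^ 2)) * (d.ρO j s' - d.EO j s') ≤ d.κB j s' ∧
      (∀ u ∈ Set.Icc 0 (d.h j s'), ∀ w' : (Fin 4 → ℤ → ℝ), d.InBall j w' (d.SpO j s') → ∀ i k, -d.Kb ≤ k → k ≤ d.Ka → |(d.TP j s' u + w') i k| ≤ d.M k - d.Λ j * d.δ j * d.τs * d.ω j k - d.mm))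

/-- (R): flow-Lipschitz products, transversal section crossing in the last sub-step, and the readouts at the
crossing states (C¹ landing allowance into the successor polytope); last clause: the sub-step Lipschitz
constant `L1` also dominates the operator bound of a fixed-time flow map started inside a node neighbourhood
(`(mC + ρO)`-guard), which the products bounded by `Λ` / `ΛX` use for their exit factor; a PREDICATE on the data.
[cite: Zgliczynski2002C1Lohner, §3–4 (Lohner-type parallelepiped frames and the C¹/variational enclosure); cell certificate format, window-truncated cascade] -/
def Readouts (d : CertData) : Prop :=
  ∀ j, j ≤ d.N₀ →
    (∀ s', s' < d.S j → d.L1 j s' ≤ d.Λ j ∧ (s' + 1 < d.S j → d.L1 j s' * d.L1 j (s' + 1) ≤ d.Λ j) ∧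
      ∀ s'', s' + 1 < s'' → s'' < d.S j → d.L1 j s' * (d.NCi j (s' + 1) * (∏ u ∈ Finset.Ico (s' + 1) s'', (1 + d.κB j u)) * (d.ρO j s'' - d.EO j s'')) * d.L1 j s'' ≤ d.Λ j) ∧
    0 < d.γ j ∧ (∀ v : (Fin 4 → ℤ → ℝ), d.InBall j v 1 → |d.σf j v| ≤ d.Nσ j) ∧
    (∀ ξ e : (Fin 4 → ℤ → ℝ), (∀ i k, -d.Kb ≤ k → k ≤ d.Ka → |ξ i k| ≤ d.rP j (d.S j - 1) i k) → d.InBall j e (d.E j (d.S j - 1)) → d.σf j (d.x j (d.S j - 1) + d.Cm j (d.S j - 1) ξ + e) < d.lev j) ∧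
    (∀ ξ e : (Fin 4 → ℤ → ℝ), (∀ i k, -d.Kb ≤ k → k ≤ d.Ka → |ξ i k| ≤ d.rP j (d.S j) i k) → d.InBall j e (d.E j (d.S j)) → d.lev j < d.σf j (d.x j (d.S j) + d.Cm j (d.S j) ξ + e)) ∧
    (∀ u ∈ Set.Icc 0 (d.h j (d.S j - 1)), ∀ w' : (Fin 4 → ℤ → ℝ), d.InBall j w' (d.Sp j (d.S j - 1)) → d.γ j ≤ d.σf j (d.Qb (d.TP j (d.S j - 1) u + w') (d.TP j (d.S j - 1) u + w'))) ∧
    (∀ u ∈ Set.Icc 0 (d.h j (d.S j - 1)), ∀ w' : (Fin 4 → ℤ → ℝ), d.InBall j w' (d.Sp j (d.S j - 1)) → d.σf j (d.TP j (d.S j - 1) u + w') = d.lev j →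
      d.as j ≤ |(d.TP j (d.S j - 1) u + w') d.i₀ 1| ∧
      (∀ i, |(d.TP j (d.S j - 1) u + w') i (-d.Kb)| + d.Λ j * d.δ j * d.τs * d.ω j (-d.Kb) ≤ (2:ℝ) ^ (-d.θ) * (d.Cb * (2:ℝ) ^ ((3:ℝ)/4 * ((d.Kb:ℝ) + 1)))) ∧
      (∀ (v : Fin 4 → ℝ) (l : ℕ), (∀ i, |v i| ≤ Real.sqrt (10*d.Cg*(2:ℝ) ^ (-(7:ℝ)*((d.Ka:ℝ) + 1)))) →
        ∀ z : (Fin 4 → ℤ → ℝ), d.InBall j z 1 → |d.ℓ (d.nx j) l (d.landD j (d.TP j (d.S j - 1) u + w') v z)| ≤ d.NDL j l)) ∧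
    (∀ u ∈ Set.Icc 0 (d.h j (d.S j - 1)), ∀ w' : (Fin 4 → ℤ → ℝ), d.InBall j w' (d.SpI j (d.S j - 1)) → d.σf j (d.TP j (d.S j - 1) u + w') = d.lev j →
      ∀ (v : Fin 4 → ℝ), (∀ i, |v i| ≤ Real.sqrt (10*d.Cg*(2:ℝ) ^ (-(7:ℝ)*((d.Ka:ℝ) + 1)))) → ∀ l, |d.ℓ (d.nx j) l (d.land j (d.TP j (d.S j - 1) u + w') v) - d.ctr (d.nx j) l| + d.β j l ≤ d.rad (d.nx j) l - d.s (d.nx j) l) ∧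
    (1 + d.bb j * (d.mT j (d.S j - 1) + d.Sp j (d.S j - 1)) ^ 2 * d.Nσ j / d.γ j) * (d.NCi j 0 * (∏ u ∈ Finset.Ico 0 (d.S j - 1), (1 + d.κB j u)) * (d.ρO j (d.S j - 1) - d.EO j (d.S j - 1))) * d.L1 j (d.S j - 1) ≤ d.ΛX j ∧
    (∀ l, 0 ≤ d.NDL j l ∧ d.NDL j l * d.ΛX j * d.dm j ≤ d.β j l) ∧
    (∀ s', s' < d.S j → 1 / (1 - d.bb j * (d.mC j s' + d.ρO j s') * d.h j s') ^ 2 ≤ d.L1 j s')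

/-- The whole certificate: `Static ∧ StageNumerics ∧ Chain ∧ Readouts` (a predicate; the summit-side item is
`∃ d, d.Valid`-shaped). [cite: MakinoBerz2003, Definition 1 (Taylor model = polynomial + remainder bound); cell certificate format, window-truncated cascade] -/
def Valid (d : CertData) : Prop := d.Static ∧ d.StageNumerics ∧ d.Chain ∧ d.Readouts

end CertData

end Literature.Analysis.FluidPDE.TaoCascade.TaylorChain

end
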